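import Summits.BirchSwinnertonDyer.BirchSwinnertonDyer.Theorems.ResidualThetaTransportAtTwoSignedMuSeedAtTwoPlusPrimCertificateGlue
import Summits.BirchSwinnertonDyer.BirchSwinnertonDyer.Theorems.ResidualThetaTransportAtTwoSignedMuVanishingAtTwoPlusCuspSpanNamed
import HarnessLib

/-!
# Crux Kμ⁺ `SignedMuVanishingAtTwoPlus` (stmt-BirchSwinnertonDyer-20689, route `ResidualThetaTransportAtTwo`) BY NAME from its THREE
# remaining named inputs: the member-free layer certificates (seed side, line `norm-one-torus` stub S3), Abbes–Ullmo Thm A (print),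
# and the curve-free cusp-span predicate `CuspSpanEvenAtTwo N` for all odd `N` (analytic side, (G′)_N)
# (width seat bsd-wall-rtt-p4-w3 g6; `--supports stmt-BirchSwinnertonDyer-20689`; closes nothing)

HONEST FRAMING. ONE THEOREM (no `def`, no named fact, no `sorry`), CONDITIONAL on three displayed hypotheses, none of which is proved
here: (i) `hcert` — for every habitat⁺ curve and every cyclotomic `(κ, γ)` a member-free layer certificate `#R[T^q] < 2^q`
(`stub_primCertificate` of `Cruxes/SignedMuSeedAtTwoPlus/Lines/norm_one_torus.lean`, unfolded; conjecture-strength as a `∀`, a finite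
computation per class — its rung `q = 1` is a classical residual `2`-descent statement over `ℚ`, `NormOneTorus.primCertificate_one_iff_classical`);
(ii) `hAU` — Abbes–Ullmo 1996 Thm A (named fact `abbesUllmo_not_dvd_maninConstant_of_not_dvd_level`, statement only in the tree);
(iii) `hG` — `SignedMuAtTwo.CuspSpanEvenAtTwo N` for every odd level `N` (@[conjecture] predicate p595076 = the `p = 2` shadow of
Perrin-Riou–Pollack `μ⁻ = 0`; verified numerically by leads g4/g5 for odd `N ≤ 2999` and the habitat⁺ conductors, open as a `∀`).
Composition of `NormOneTorus.signedMuVanishingAtTwoPlus_of_primCertificates_of_analytic` (p606860) with lead g5's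
`SignedMuAtTwo.signedMuAnalyticAtTwoPlus_of_abbesUllmo_of_forall_cuspSpanEvenAtTwo` (p596171). It records in the kernel what the crux
needs TODAY; BSD is not proved by any of this and nothing about any particular curve is asserted.

References: [Fukuda1994] Thm. 1; [GreenbergVatsal2000] Prop. (2.8); [AbbesUllmo1996] Thm. A; [Pollack2003] Conj. 6.3, Prop. 6.18.
-/

set_option autoImplicit false
-- D-0017: single-problem summit, so `Summit.BirchSwinnertonDyer.BirchSwinnertonDyer.…` repeats a namespace BY DESIGN.
set_option linter.dupNamespace false

noncomputable section

open scoped Classical AddSubgroup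

open WeierstrassCurve NumberField IsDedekindDomain Literature Literature.NumberTheory.EllipticCurves
  Literature.NumberTheory.EllipticCurves.ModularForms
  Literature.NumberTheory.GaloisRepresentations Literature.NumberTheory.EllipticCurves.GreenbergVatsal2000
  Literature.NumberTheory.EllipticCurves.Kobayashi2003 ZpExtension
  Literature.NumberTheory.EllipticCurves.GreenbergSelmer
  Literature.NumberTheory.EllipticCurves.Rank1Residual Literature.NumberTheory.EllipticCurves.IwasawaAlgebra
  Summit.BirchSwinnertonDyer.BirchSwinnertonDyer.Theses.ResidualThetaTransportAtTwo
  Summit.BirchSwinnertonDyer.BirchSwinnertonDyer.Theorems.SignedTransportAtTwo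

namespace Summit.BirchSwinnertonDyer.BirchSwinnertonDyer.Theorems.SignedMuAtTwo.NormOneTorus

/-- **Kμ⁺ ⟸ {S3 certificates, Abbes–Ullmo, (G′)_N ∀ odd N}.** The crux `SignedMuVanishingAtTwoPlus` BY NAME from: (i) for every
habitat⁺ curve `W` and cyclotomic `(κ, γ)`, some `q ≥ 1` and a finite set of fewer than `2^q` classes exhausting the `T^q`-torsion of the
primitive residual signed-plus set of `W[2^∞][2]` over `ℚ_∞` (`T = conj_γ − 1`); (ii) Abbes–Ullmo Thm A; (iii) `CuspSpanEvenAtTwo N` for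
every odd `N`. (i) ⟹ the seed child 21438 (`signedMuSeedAtTwoPlus_of_primCertificates`); (ii) ∧ (iii) ⟹ the analytic child 21437
(`signedMuAnalyticAtTwoPlus_of_abbesUllmo_of_forall_cuspSpanEvenAtTwo`); 21437 ∧ 21438 ⟹ the crux (p585569).
[cite: Fukuda1994, Thm. 1] [cite: GreenbergVatsal2000, p. 3 and Prop. (2.8)] [cite: AbbesUllmo1996, Thm. A] [cite: Pollack2003, Conj. 6.3 and Prop. 6.18] -/
theorem signedMuVanishingAtTwoPlus_of_primCertificates_of_abbesUllmo_of_forall_cuspSpanEvenAtTwo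
    (hcert : ∀ (W : WeierstrassCurve ℚ) [W.IsElliptic] [W.IsGloballyMinimal], ¬ W.HasCM → W.analyticRank = 0 →
      GoodSS W 2 → W.frobeniusTrace 2 = 0 → W.Δ < 0 →
      ∀ (κ : ZpExtension ℚ 2) (γ : Field.absoluteGaloisGroup ℚ), κ.IsCyclotomic → κ.IsTopGenerator γ →
      ∃ q : ℕ, 1 ≤ q ∧
        ∃ F : Finset (subgroupH1 κ.kerSubgroup ↥((↥(W.geomPrimaryTorsion 2))[(2 : ℤ)])),
          (∀ c, c ∈ F ↔ (c ∈
            {c : subgroupH1 κ.kerSubgroup ↥((↥(W.geomPrimaryTorsion 2))[(2 : ℤ)]) |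
              c ∈ unramifiedOutside κ.kerSubgroup ↥((↥(W.geomPrimaryTorsion 2))[(2 : ℤ)]) 2
                    (∅ : Set (HeightOneSpectrum (𝓞 ℚ))) ∧
                (∀ (w : InfinitePlace ℚ) (σ : Field.absoluteGaloisGroup ℚ),
                  Literature.NumberTheory.EllipticCurves.conjH1 κ.kerSubgroup ↥((↥(W.geomPrimaryTorsion 2))[(2 : ℤ)]) σ c ∈
                    GreenbergSelmer.infKer κ.kerSubgroup ↥((↥(W.geomPrimaryTorsion 2))[(2 : ℤ)]) w) ∧
                (∀ (v : HeightOneSpectrum (𝓞 ℚ)), ((2 : ℕ) : 𝓞 ℚ) ∈ v.asIdeal → ∀ σ : Field.absoluteGaloisGroup ℚ,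
                  W.conjH1 2 κ.kerSubgroup σ
                      (pushH1 κ.kerSubgroup ((↥(W.geomPrimaryTorsion 2))[(2 : ℤ)]).subtype (subtype_torsionBy_smul W 2) c) ∈
                    localKummerOverOfEmb W 2 κ.kerSubgroup (closureEmb (K := ℚ) (v.adicCompletion ℚ))
                      (⨆ n : ℕ, signedLocalPoints κ (v.adicCompletion ℚ) W 1 n))} ∧
            ((@HSub.hSub (AddMonoid.End (subgroupH1 κ.kerSubgroup ↥((↥(W.geomPrimaryTorsion 2))[(2 : ℤ)])))
                (AddMonoid.End (subgroupH1 κ.kerSubgroup ↥((↥(W.geomPrimaryTorsion 2))[(2 : ℤ)])))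
                (AddMonoid.End (subgroupH1 κ.kerSubgroup ↥((↥(W.geomPrimaryTorsion 2))[(2 : ℤ)]))) instHSub
                (Literature.NumberTheory.EllipticCurves.conjH1 κ.kerSubgroup ↥((↥(W.geomPrimaryTorsion 2))[(2 : ℤ)]) γ) 1) ^
              q) c = 0)) ∧
          F.card < 2 ^ q)
    (hAU : abbesUllmo_not_dvd_maninConstant_of_not_dvd_level)
    (hG : ∀ (N : ℕ) [NeZero N], ¬ 2 ∣ N → CuspSpanEvenAtTwo N) :
    SignedMuVanishingAtTwoPlus :=
  signedMuVanishingAtTwoPlus_of_primCertificates_of_analytic hcert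
    (signedMuAnalyticAtTwoPlus_of_abbesUllmo_of_forall_cuspSpanEvenAtTwo hAU hG)

end Summit.BirchSwinnertonDyer.BirchSwinnertonDyer.Theorems.SignedMuAtTwo.NormOneTorus

end
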